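import Mathlib
import Literature.NumberTheory.Transcendental.KZRulesAssociator
import Literature.NumberTheory.Transcendental.KZProductIdeal
import Literature.NumberTheory.Transcendental.KZGaussMultiplicationChain
import Literature.NumberTheory.Transcendental.KontsevichZagierGammaProofs
import Literature.NumberTheory.EllipticCurves.GaussianLatticeQuarterValues
import Summits.KontsevichZagierPeriods.KontsevichZagierPeriods.Theorems.HyperbolicBlochOffTetraSectorKernelStubLindemannRing
import Summits.KontsevichZagierPeriods.KontsevichZagierPeriods.Theorems.TerasomaMultiplicationGammaHodgeSectorDefs

/-!
# Stub `stub_chudnovskyRing` — crux `OffTetraSectorKernel`, line `odd-hyperbolic-ladder` (skeleton v8, lead c6)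

CONJECTURE 1 HOLDS ON CHUDNOVSKY'S RING — THE CIRCLE AND THE LEMNISCATE. The method of `stub_lindemannRing` for
SEVERAL generators (`algIndepRing_kernel`): in the formal period ring `P = FormalRep ⧸ relations`, the subring
generated by the algebraic points `⟦[pt, a]⟧` and classes `t i` whose values are ALGEBRAICALLY INDEPENDENT over `ℚ`
meets the kernel of `evalP` only in `0` — its elements are `p(t)`, `p ∈ K[Xᵢ]`, `K = algebraicClosure ℚ ℝ`
(`MvPolynomial.eval₂Hom`), `evalP (p(t)) = p(evalP ∘ t)`, and algebraic independence persists over the algebraic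
extension `K/ℚ` (`AlgebraicIndependent.extendScalars`). EVERY algebraic-independence theorem proved in the tree thus
closes a ring sector of the residue. The deepest one is CHUDNOVSKY's (1976; tree theorem
`algebraicIndependent_pi_of_pow_mem_adjoin`, sorry-free, fed by Chudnovsky's Theorem 7.2.6): `π` and the real period
`ϖ₀ = Γ(¼)²/(2√(2π))` of the lemniscatic curve `y² = 4x³ − 4x` are algebraically independent. In Beta form
`B(¼,½) = Γ(¼)Γ(½)/Γ(¾) = 2ϖ₀` (`chudnovsky_beta_sq`), and `B(¼,½)` is the value of Euler's Beta representation
`β(¼,½) = [(0,1), t^{-3/4}(1−t)^{-1/2}]` (`= 4·[(0,1), (1−x⁴)^{-1/2}]`, the lemniscate arc, by `u = x⁴`).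

THEOREM (`stub_chudnovskyRing`): on the subring of `P` generated by the algebraic points, the arctangent carriers
`⟦[(0,1), 1/(1+t²)]⟧` (value `π/4`) and the Beta carriers `⟦β(¼,½)⟧` (value `B(¼,½)`), `evalP x = 0 → x = 0`. It
contains Lindemann's ring; it is the first closed sector of the residue containing an ELLIPTIC period: every
polynomial identity with algebraic coefficients between `π` and `ϖ₀` carried by products of discs, balls, even zeta
boxes and lemniscatic Beta boxes is a chain of moves — and there is none but the move-trivial ones.

References: G. V. Chudnovsky, *Contributions to the theory of transcendental numbers* (1984), Ch. 7; M. Waldschmidt,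
*Elliptic functions and transcendence* (2008), §5.2; M. Kontsevich, D. Zagier, *Periods* (2001), §1.2, §4.1.
-/

noncomputable section

open Set MeasureTheory
open Literature.NumberTheory.Transcendental

namespace Summit.KontsevichZagierPeriods.HyperbolicBloch.OffTetraSectorKernel

/-! ## The multi-generator principle -/

/-- **ALGEBRAICALLY-INDEPENDENT-GENERATORS PRINCIPLE.** Let `t : ι → P` have values `evalP ∘ t` algebraically
independent over `ℚ`, and let `G ⊆ P` consist of copies of the `t i`. Then on the subring generated by the
algebraic points and `G`, `evalP x = 0 → x = 0`: every element is `p(t)` for `p ∈ K[Xᵢ]`,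
`K = algebraicClosure ℚ ℝ` (the points are the image of `K →+* P`), `evalP (p(t)) = p(evalP ∘ t)`
(`MvPolynomial.eval₂_comp_left`), and `evalP ∘ t` stays algebraically independent over `K`
(`AlgebraicIndependent.extendScalars`), so `p = 0`. [cite: KontsevichZagier2001, §4.1] -/
theorem algIndepRing_kernel {ι : Type*} (t : ι → KZ.FormalPeriodRing)
    (ht : AlgebraicIndependent ℚ (fun i => KZ.evalP (t i))) (G : Set KZ.FormalPeriodRing)
    (hG : ∀ g ∈ G, ∃ i, g = t i) :
    ∀ x ∈ Subring.closure
        ({p : KZ.FormalPeriodRing | ∃ (a : ℝ) (ha : IsAlgebraic ℚ a),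
            p = KZ.toFormalPeriod (KZ.of (KZ.IntegralRep.unit.constMul a ha))} ∪ G),
      KZ.evalP x = 0 → x = 0 := by
  intro x hx hx0
  let K := algebraicClosure ℚ ℝ
  haveI hKalg : Algebra.IsAlgebraic ℚ K := algebraicClosure.isAlgebraic ℚ ℝ
  let φ : K →+* KZ.FormalPeriodRing :=
    { toFun := fun a => KZ.toFormalPeriod
        (KZ.of (KZ.IntegralRep.unit.constMul (a : ℝ) ((mem_algebraicClosure_iff).mp a.2)))
      map_one' := (lindemann_pt_congr _ isAlgebraic_one (by simp)).trans lindemann_pt_one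
      map_mul' := fun a b =>
        (lindemann_pt_congr _ (((mem_algebraicClosure_iff).mp a.2).mul
          ((mem_algebraicClosure_iff).mp b.2)) (by push_cast; rfl)).trans (lindemann_pt_mul _ _)
      map_zero' := (lindemann_pt_congr _ isAlgebraic_zero (by simp)).trans lindemann_pt_zero
      map_add' := fun a b =>
        (lindemann_pt_congr _ (((mem_algebraicClosure_iff).mp a.2).add
          ((mem_algebraicClosure_iff).mp b.2)) (by push_cast; rfl)).trans (lindemann_pt_add _ _) }
  have hφ : ∀ a : K, KZ.evalP (φ a) = (a : ℝ) := fun a => lindemann_evalP_pt _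
  have hle : Subring.closure
      ({p : KZ.FormalPeriodRing | ∃ (a : ℝ) (ha : IsAlgebraic ℚ a),
          p = KZ.toFormalPeriod (KZ.of (KZ.IntegralRep.unit.constMul a ha))} ∪ G) ≤
        (MvPolynomial.eval₂Hom φ t).range := by
    refine (Subring.closure_le).mpr ?_
    rintro q (⟨a, ha, rfl⟩ | hq)
    · refine ⟨MvPolynomial.C (⟨a, (mem_algebraicClosure_iff).mpr ha⟩ : K), ?_⟩
      rw [MvPolynomial.eval₂Hom_C]
      rfl
    · obtain ⟨i, rfl⟩ := hG q hq
      exact ⟨MvPolynomial.X i, MvPolynomial.eval₂Hom_X' φ t i⟩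
  obtain ⟨p, hp⟩ := hle hx
  have hcomp : KZ.evalP.comp φ = algebraMap K ℝ := by
    ext a
    rw [RingHom.comp_apply, hφ]
    rfl
  have hev : KZ.evalP x = MvPolynomial.aeval (fun i => KZ.evalP (t i)) p := by
    rw [← hp, MvPolynomial.coe_eval₂Hom, MvPolynomial.eval₂_comp_left, hcomp, MvPolynomial.aeval_def]
    rfl
  have hK : AlgebraicIndependent K (fun i => KZ.evalP (t i)) := ht.extendScalars K
  have hp0 : p = 0 := hK.eq_zero_of_aeval_eq_zero p (by rw [← hev, hx0])
  rw [← hp, hp0, map_zero]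

/-! ## Rescaling an algebraically independent pair -/

/-- Algebraic independence of a pair survives rescaling the first coordinate by a non-zero rational
(the substitution `X₀ ↦ c·X₀` is an automorphism of `ℚ[X₀, X₁]`). [folklore] -/
theorem algebraicIndependent_pair_smul {a b : ℝ} (h : AlgebraicIndependent ℚ ![a, b]) {c : ℚ} (hc : c ≠ 0) :
    AlgebraicIndependent ℚ ![(c : ℝ) * a, b] := by
  rw [algebraicIndependent_iff]
  intro p hp
  -- substitute `X₀ ↦ C c * X₀`
  set w : Fin 2 → MvPolynomial (Fin 2) ℚ := ![MvPolynomial.C c * MvPolynomial.X 0, MvPolynomial.X 1] with hw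
  have hq : MvPolynomial.aeval ![a, b] (MvPolynomial.bind₁ w p) = 0 := by
    rw [MvPolynomial.aeval_bind₁]
    have e : (fun i => MvPolynomial.aeval ![a, b] (w i)) = ![(c : ℝ) * a, b] := by
      funext i
      fin_cases i
      · simp [hw]
      · simp [hw]
    rw [e, hp]
  have h0 : MvPolynomial.bind₁ w p = 0 := h.eq_zero_of_aeval_eq_zero _ hq
  -- undo the substitution
  set w' : Fin 2 → MvPolynomial (Fin 2) ℚ := ![MvPolynomial.C c⁻¹ * MvPolynomial.X 0, MvPolynomial.X 1] with hw'
  have hid : ∀ i, MvPolynomial.bind₁ w' (w i) = MvPolynomial.X i := by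
    intro i
    fin_cases i
    · show MvPolynomial.bind₁ w' (MvPolynomial.C c * MvPolynomial.X 0) = MvPolynomial.X 0
      rw [map_mul, MvPolynomial.bind₁_C_right, MvPolynomial.bind₁_X_right]
      show MvPolynomial.C c * (MvPolynomial.C c⁻¹ * MvPolynomial.X 0) = MvPolynomial.X 0
      rw [← mul_assoc, ← MvPolynomial.C_mul, mul_inv_cancel₀ hc, MvPolynomial.C_1, one_mul]
    · show MvPolynomial.bind₁ w' (MvPolynomial.X 1) = MvPolynomial.X 1
      rw [MvPolynomial.bind₁_X_right]
      rfl
  have : p = MvPolynomial.bind₁ w' (MvPolynomial.bind₁ w p) := by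
    rw [MvPolynomial.bind₁_bind₁]
    have e : (fun i => MvPolynomial.bind₁ w' (w i)) = MvPolynomial.X := funext hid
    rw [e, MvPolynomial.bind₁_X_left]
    rfl
  rw [this, h0, map_zero]

/-! ## Chudnovsky's theorem in Beta form -/

/-- `B(¼,½)² = Γ(¼)⁴/(2π)`: `Γ(½) = √π` and `Γ(¼)Γ(¾) = π/sin(π/4) = √2·π`. [folklore] -/
theorem chudnovsky_beta_sq :
    ProbabilityTheory.beta (((1 / 4 : ℚ)) : ℝ) (((1 / 2 : ℚ)) : ℝ) ^ 2 = Real.Gamma (1 / 4) ^ 4 / (2 * Real.pi) := by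
  have hg : 0 < Real.Gamma (1 / 4) := Real.Gamma_pos_of_pos (by norm_num)
  have hrefl : Real.Gamma (1 / 4) * Real.Gamma (3 / 4) = Real.sqrt 2 * Real.pi := by
    have h := Real.Gamma_mul_Gamma_one_sub (1 / 4 : ℝ)
    rw [show (1 : ℝ) - 1 / 4 = 3 / 4 by norm_num, show Real.pi * (1 / 4) = Real.pi / 4 by ring,
      Real.sin_pi_div_four] at h
    rw [h]
    have hs : Real.sqrt 2 ≠ 0 := by positivity
    have hs2 : Real.sqrt 2 * Real.sqrt 2 = 2 := Real.mul_self_sqrt (by norm_num)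
    field_simp
    nlinarith [hs2]
  have h34 : Real.Gamma (3 / 4) = Real.sqrt 2 * Real.pi / Real.Gamma (1 / 4) := by
    rw [← hrefl]
    field_simp
  have hcast1 : (((1 / 4 : ℚ)) : ℝ) = 1 / 4 := by push_cast; ring
  have hcast2 : (((1 / 2 : ℚ)) : ℝ) = 1 / 2 := by push_cast; ring
  rw [hcast1, hcast2, ProbabilityTheory.beta, show (1 : ℝ) / 4 + 1 / 2 = 3 / 4 by norm_num,
    Real.Gamma_one_half_eq, h34]
  have hs2 : Real.sqrt 2 ^ 2 = 2 := Real.sq_sqrt (by norm_num)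
  have hsp : Real.sqrt Real.pi ^ 2 = Real.pi := Real.sq_sqrt Real.pi_pos.le
  have hs : Real.sqrt 2 ≠ 0 := by positivity
  have hp : Real.pi ≠ 0 := Real.pi_ne_zero
  field_simp
  rw [hs2, hsp]
  ring

/-- **CHUDNOVSKY (1976) in Beta form: `π` and `B(¼,½)` are algebraically independent over `ℚ`.** From the tree's
`algebraicIndependent_pi_of_pow_mem_adjoin` for the lemniscatic period pair (`exists_lemniscatic_periodPair`:
`ω₁ = ϖ₀`, `η₁ω₁ = π`) with `x = B(¼,½)`: `ω₁² = ϖ₀² = Γ(¼)⁴/(8π) = B(¼,½)²/4 ∈ ℚ(π, x)` and `η₁ω₁ = π ∈ ℚ(π, x)`;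
then restriction from `ℂ` to `ℝ`. [cite: Chudnovsky1984, Ch. 7 §2 Corollary 2.3 (p. 307)] -/
theorem chudnovsky_pi_beta :
    AlgebraicIndependent ℚ ![Real.pi, ProbabilityTheory.beta (((1 / 4 : ℚ)) : ℝ) (((1 / 2 : ℚ)) : ℝ)] := by
  set B : ℝ := ProbabilityTheory.beta (((1 / 4 : ℚ)) : ℝ) (((1 / 2 : ℚ)) : ℝ) with hB
  obtain ⟨L, hg₂, hg₃, hω₁, hη⟩ := exists_lemniscatic_periodPair
  set K : IntermediateField ℚ ℂ := IntermediateField.adjoin ℚ ({(Real.pi : ℂ), (B : ℂ)} : Set ℂ) with hK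
  have hBK : (B : ℂ) ∈ K := IntermediateField.subset_adjoin ℚ _ (by simp)
  have hπK : (Real.pi : ℂ) ∈ K := IntermediateField.subset_adjoin ℚ _ (by simp)
  -- `ω₁² = B²/4`
  have hϖ : (Real.Gamma (1 / 4) ^ 2 / (2 * Real.sqrt (2 * Real.pi)) : ℝ) ^ 2 = B ^ 2 / 4 := by
    rw [Literature.NumberTheory.EllipticCurves.GaussianLattice.varpi_sq, hB, chudnovsky_beta_sq]
    have hp : Real.pi ≠ 0 := Real.pi_ne_zero
    field_simp
    ring
  have hω : L.ω₁ ^ 2 ∈ K := by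
    have e : L.ω₁ ^ 2 = (B : ℂ) ^ 2 / 4 := by
      rw [hω₁, ← Complex.ofReal_pow, hϖ]
      push_cast
      ring
    rw [e]
    exact div_mem (pow_mem hBK 2) (by exact_mod_cast (natCast_mem K 4))
  have hηω : (L.η₁ * L.ω₁) ^ 1 ∈ K := by
    rw [pow_one, hη]
    exact hπK
  have halg₂ : IsAlgebraic ℚ L.g₂ := by
    rw [hg₂]
    exact_mod_cast isAlgebraic_nat (R := ℚ) (A := ℂ) 4
  have halg₃ : IsAlgebraic ℚ L.g₃ := by
    rw [hg₃]
    exact isAlgebraic_zero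
  have hC : AlgebraicIndependent ℚ ![(Real.pi : ℂ), (B : ℂ)] :=
    algebraicIndependent_pi_of_pow_mem_adjoin halg₂ halg₃ (B : ℂ) two_pos one_pos hω hηω
  -- restriction from `ℂ` to `ℝ`
  refine AlgebraicIndependent.of_comp (Complex.ofRealAm.restrictScalars ℚ) ?_
  convert hC using 1
  funext i
  fin_cases i <;> rfl

/-- **Chudnovsky for the generators' values**: `π/4` and `B(¼,½)` are algebraically independent over `ℚ`.
[cite: Chudnovsky1984, Ch. 7 §2 Corollary 2.3 (p. 307)] -/
theorem chudnovsky_pi_div_four_beta :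
    AlgebraicIndependent ℚ ![Real.pi / 4, ProbabilityTheory.beta (((1 / 4 : ℚ)) : ℝ) (((1 / 2 : ℚ)) : ℝ)] := by
  have h := algebraicIndependent_pair_smul chudnovsky_pi_beta (c := 1 / 4) (by norm_num)
  convert h using 2
  push_cast
  ring

/-! ## Chudnovsky's ring -/

/-- A pinned Beta carrier `[(0,1), t^{¼−1}(1−t)^{½−1}]` is a `β(¼,½)`-representation of route
TerasomaMultiplication's vocabulary, hence has the class `betaClass ¼ ½`. [cite: KontsevichZagier2001, §1.1] -/
theorem chudnovsky_beta_class_eq (H : KZ.IntegralRep 1) (hHd : H.domain = {t | t 0 ∈ Set.Ioo (0:ℝ) 1})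
    (hHi : Set.EqOn H.integrand
      (fun t => (t 0) ^ (((1 / 4 : ℚ) : ℝ) - 1) * (1 - t 0) ^ (((1 / 2 : ℚ) : ℝ) - 1)) H.domain) :
    KZ.toFormalPeriod (KZ.of H) = Summit.KontsevichZagierPeriods.GammaHodgeSectorKO.betaClass (1 / 4) (1 / 2) :=
  Summit.KontsevichZagierPeriods.GammaHodgeSectorKO.IsBetaRep.toFormalPeriod_eq (by norm_num) (by norm_num)
    ⟨hHd, fun x hx => by rw [hHi hx]; rfl⟩

/-- **STUB `stub_chudnovskyRing`: CONJECTURE 1 HOLDS ON CHUDNOVSKY'S RING — THE CIRCLE AND THE LEMNISCATE.** On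
the subring of the formal period ring `P = FormalRep ⧸ relations` generated by the algebraic points `⟦[pt, a]⟧`,
the arctangent carriers `⟦[(0,1), 1/(1+t²)]⟧` (value `π/4`) and Euler's Beta carriers
`⟦[(0,1), t^{-3/4}(1−t)^{-1/2}]⟧` (value `B(¼,½) = 2ϖ₀`, twice the real period of the lemniscatic curve
`y² = 4x³ − 4x`; four times the lemniscate arc `∫₀¹ dx/√(1−x⁴)`), `evalP x = 0 → x = 0`: every element is
`p(⟦A⟧, ⟦β(¼,½)⟧)` for a polynomial `p` with real-algebraic coefficients, and `p(π/4, B(¼,½)) = 0` forces `p = 0`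
by CHUDNOVSKY's theorem (π and ϖ₀ are algebraically independent; tree theorem
`algebraicIndependent_pi_of_pow_mem_adjoin`, sorry-free). The first closed sector of the residue containing an
elliptic period. [cite: Chudnovsky1984, Ch. 7 §2 Corollary 2.3 (p. 307)] [cite: KontsevichZagier2001, §1.2] -/
theorem stub_chudnovskyRing :
    ∀ x ∈ Subring.closure
        ({p : KZ.FormalPeriodRing | ∃ (a : ℝ) (ha : IsAlgebraic ℚ a),
            p = KZ.toFormalPeriod (KZ.of (KZ.IntegralRep.unit.constMul a ha))} ∪
          ({p : KZ.FormalPeriodRing | ∃ A : KZ.IntegralRep 1, A.domain = {t | t 0 ∈ Set.Ioo (0:ℝ) 1} ∧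
            Set.EqOn A.integrand (fun t => 1 / (1 + t 0 ^ 2)) A.domain ∧ p = KZ.toFormalPeriod (KZ.of A)} ∪
          {p : KZ.FormalPeriodRing | ∃ H : KZ.IntegralRep 1, H.domain = {t | t 0 ∈ Set.Ioo (0:ℝ) 1} ∧
            Set.EqOn H.integrand (fun t => (t 0) ^ (((1 / 4 : ℚ) : ℝ) - 1) * (1 - t 0) ^ (((1 / 2 : ℚ) : ℝ) - 1))
              H.domain ∧ p = KZ.toFormalPeriod (KZ.of H)})),
      KZ.evalP x = 0 → x = 0 := by
  obtain ⟨A₀, hA₀d, hA₀i⟩ := lindemann_exists_arc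
  have ht0 : KZ.evalP (KZ.toFormalPeriod (KZ.of A₀)) = Real.pi / 4 := lindemann_evalP_arc A₀ hA₀d hA₀i
  have ht1 : KZ.evalP (Summit.KontsevichZagierPeriods.GammaHodgeSectorKO.betaClass (1 / 4) (1 / 2)) =
      ProbabilityTheory.beta (((1 / 4 : ℚ)) : ℝ) (((1 / 2 : ℚ)) : ℝ) :=
    Summit.KontsevichZagierPeriods.GammaHodgeSectorKO.evalP_betaClass (1 / 4) (1 / 2) (by norm_num) (by norm_num)
  refine algIndepRing_kernel
    ![KZ.toFormalPeriod (KZ.of A₀), Summit.KontsevichZagierPeriods.GammaHodgeSectorKO.betaClass (1 / 4) (1 / 2)]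
    ?_ _ ?_
  · convert chudnovsky_pi_div_four_beta using 1
    funext i
    fin_cases i
    · exact ht0
    · exact ht1
  · rintro g (⟨A, hAd, hAi, rfl⟩ | ⟨H, hHd, hHi, rfl⟩)
    · exact ⟨0, lindemann_arc_class_eq A A₀ hAd hAi hA₀d hA₀i⟩
    · exact ⟨1, chudnovsky_beta_class_eq H hHd hHi⟩

/-- **CHUDNOVSKY'S RING IS A CLOSED SECTOR OF THE RESIDUE**: on the formal combinations whose class lies in the ring
of the circle and the lemniscate, `ker eval ≤ relations`. [cite: KontsevichZagier2001, §1.2] -/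
theorem chudnovskyRing_inf_ker_le_relations :
    KZ.eval.ker ⊓ (Subring.closure
        ({p : KZ.FormalPeriodRing | ∃ (a : ℝ) (ha : IsAlgebraic ℚ a),
            p = KZ.toFormalPeriod (KZ.of (KZ.IntegralRep.unit.constMul a ha))} ∪
          ({p : KZ.FormalPeriodRing | ∃ A : KZ.IntegralRep 1, A.domain = {t | t 0 ∈ Set.Ioo (0:ℝ) 1} ∧
            Set.EqOn A.integrand (fun t => 1 / (1 + t 0 ^ 2)) A.domain ∧ p = KZ.toFormalPeriod (KZ.of A)} ∪
          {p : KZ.FormalPeriodRing | ∃ H : KZ.IntegralRep 1, H.domain = {t | t 0 ∈ Set.Ioo (0:ℝ) 1} ∧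
            Set.EqOn H.integrand (fun t => (t 0) ^ (((1 / 4 : ℚ) : ℝ) - 1) * (1 - t 0) ^ (((1 / 2 : ℚ) : ℝ) - 1))
              H.domain ∧ p = KZ.toFormalPeriod (KZ.of H)}))).toAddSubgroup.comap
        KZ.toFormalPeriod.toAddMonoidHom ≤ KZ.relations := by
  rintro c ⟨hc, hS⟩
  have hc0 : KZ.eval c = 0 := hc
  exact KZ.toFormalPeriod_eq_zero_iff.mp
    (stub_chudnovskyRing _ hS (by rw [KZ.evalP_toFormalPeriod, hc0]))

/-- **EQUAL VALUES ⇒ EQUAL CLASSES across Chudnovsky's ring** (discs, balls, even zeta boxes, lemniscatic Beta boxes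
and all their products, jointly). [cite: KontsevichZagier2001, §1.2] -/
theorem chudnovskyRing_eq_of_evalP_eq {x y : KZ.FormalPeriodRing}
    (hx : x ∈ Subring.closure
        ({p : KZ.FormalPeriodRing | ∃ (a : ℝ) (ha : IsAlgebraic ℚ a),
            p = KZ.toFormalPeriod (KZ.of (KZ.IntegralRep.unit.constMul a ha))} ∪
          ({p : KZ.FormalPeriodRing | ∃ A : KZ.IntegralRep 1, A.domain = {t | t 0 ∈ Set.Ioo (0:ℝ) 1} ∧
            Set.EqOn A.integrand (fun t => 1 / (1 + t 0 ^ 2)) A.domain ∧ p = KZ.toFormalPeriod (KZ.of A)} ∪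
          {p : KZ.FormalPeriodRing | ∃ H : KZ.IntegralRep 1, H.domain = {t | t 0 ∈ Set.Ioo (0:ℝ) 1} ∧
            Set.EqOn H.integrand (fun t => (t 0) ^ (((1 / 4 : ℚ) : ℝ) - 1) * (1 - t 0) ^ (((1 / 2 : ℚ) : ℝ) - 1))
              H.domain ∧ p = KZ.toFormalPeriod (KZ.of H)})))
    (hy : y ∈ Subring.closure
        ({p : KZ.FormalPeriodRing | ∃ (a : ℝ) (ha : IsAlgebraic ℚ a),
            p = KZ.toFormalPeriod (KZ.of (KZ.IntegralRep.unit.constMul a ha))} ∪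
          ({p : KZ.FormalPeriodRing | ∃ A : KZ.IntegralRep 1, A.domain = {t | t 0 ∈ Set.Ioo (0:ℝ) 1} ∧
            Set.EqOn A.integrand (fun t => 1 / (1 + t 0 ^ 2)) A.domain ∧ p = KZ.toFormalPeriod (KZ.of A)} ∪
          {p : KZ.FormalPeriodRing | ∃ H : KZ.IntegralRep 1, H.domain = {t | t 0 ∈ Set.Ioo (0:ℝ) 1} ∧
            Set.EqOn H.integrand (fun t => (t 0) ^ (((1 / 4 : ℚ) : ℝ) - 1) * (1 - t 0) ^ (((1 / 2 : ℚ) : ℝ) - 1))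
              H.domain ∧ p = KZ.toFormalPeriod (KZ.of H)})))
    (h : KZ.evalP x = KZ.evalP y) : x = y :=
  sub_eq_zero.mp (stub_chudnovskyRing _ (Subring.sub_mem _ hx hy) (by rw [map_sub, h, sub_self]))

end Summit.KontsevichZagierPeriods.HyperbolicBloch.OffTetraSectorKernel

end
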